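import Summits.HubbardSuperconductivity.HubbardSuperconductivity.Theorems.KLProgrammeKLRegimeScaleZeroCovarianceStripDecaySample

/-!
# Route `KLProgramme`, crux K3 — engine-flow child (stmt-HubbardSuperconductivity-20437), stub (C) at `n = 0`, located item #22a «(C)-SCALE0-PT2»,
# the FAR-SITE supplier, HIGH shell: THE EXPONENTIAL LATTICE RING SUM (the weight sum that p1 g21's strip door leaves behind)

Seat hubbard-kl-k3c5-p1 (g14; owner of #22a).  On the cutoff-free shell `|ω| ≥ klE0` p1 g21's door
`…ScaleZeroCovarianceStripDecaySample.norm_torusFourierInv_uvSpatialSample_le_exp` gives `‖TFI_ω(z)‖ ≤ 25·(2/|ω|)·e^{−κ‖z‖∞}`, `κ = arsinh(|ω|/4)`.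
Feeding it into the TWO-SHELLS interface `…SunsetFarRowsL2.farRows_le_of_l2Far` leaves ONE lattice sum per frequency:
`Σ_{z ∈ ℤ², ‖z‖∞ > Rc} (1+‖z‖∞)ᵏ·e^{−2κ‖z‖∞}`.  This file bounds it in closed form (pure real analysis on `ℤ²`):
* §1 `one_add_pow_mul_exp_neg_le` — the polynomial weight costs a constant: `(1+t)ᵏ·e^{−ct} ≤ max(1, k/c)ᵏ` (`t ≥ 0`, `c > 0`);
* §2 **`tsum_far_pow_mul_exp_le`** — `Σ'_{z} [Rc < ‖z‖∞]·(1+‖z‖∞)ᵏ e^{−2κ‖z‖∞} ≤ max(1, 2k/κ)ᵏ · e^{−κ(Rc+1)} · (1 + 2/(1 − e^{−κ/4}))²`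
  (split `e^{−2κr} = e^{−κr/2}·e^{−κr}·e^{−κr/2}`: the first factor absorbs the weight, the second gives the decay at the ring `r ≥ Rc+1`, the third is summed
  over ALL of `ℤ²` by p1's `tsum_site_two_prod_weight` with `ρ = e^{−κ/4}`), with summability.
Sizes [by hand, labelled]: at `ω₁ = 0.3` (`κ ≈ 0.075`), `Rc = 1024`, `k = 2`: `max(1,4/κ)² ≈ 2.8·10³`, `(1+2/(1−e^{−κ/4}))² ≈ 1.2·10⁴`, `e^{−κ·1025} ≈ 10⁻³³`
⇒ the high shell is negligible for `ω₁ ≳ 0.25` at `Rc = 1024`; at `ω₁ = 0.1` it needs `Rc ≈ 2048` (the door's rate `arsinh(ω/4) ≈ ω/4` is conservative).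

No definitions; nothing here asserts (C), any stub of 20437, K3 or superconductivity.
References: BGM 2006 §2.2 footnote 1, §3 (3.2) [cite: BenfattoGiulianiMastropietro2006]; Glimm–Jaffe Prop. 7.3.1 [cite: GlimmJaffeQP1987].
-/

noncomputable section

namespace Summit.HubbardSuperconductivity.HubbardSuperconductivity.Theorems.KLRegimeSplit

set_option linter.dupNamespace false -- summit = problem name (single-conjunct summit), D-0017

open Literature.Probability.LatticeModels Real

/-! ## §1 The polynomial weight against half of the exponential -/

/-- **`(1+t)ᵏ·e^{−ct} ≤ max(1, k/c)ᵏ`** for `t ≥ 0`, `c > 0` (from `e^{ct/k} ≥ 1 + ct/k`). -/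
theorem one_add_pow_mul_exp_neg_le {t c : ℝ} (ht : 0 ≤ t) (hc : 0 < c) (k : ℕ) :
    (1 + t) ^ k * Real.exp (-(c * t)) ≤ (max 1 ((k : ℝ) / c)) ^ k := by
  rcases Nat.eq_zero_or_pos k with hk | hk
  · subst hk
    simp only [pow_zero, one_mul]
    exact Real.exp_le_one_iff.2 (by nlinarith)
  have hkr : (0 : ℝ) < k := by exact_mod_cast hk
  set m : ℝ := max 1 ((k : ℝ) / c) with hm
  have hm1 : 1 ≤ m := le_max_left _ _
  have hm0 : 0 < m := lt_of_lt_of_le one_pos hm1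
  have hmc : (k : ℝ) / c ≤ m := le_max_right _ _
  -- `1 + t ≤ m·(1 + ct/k)` and `(1 + ct/k)ᵏ ≤ e^{ct}`
  have h1 : 1 + t ≤ m * (1 + c * t / k) := by
    have : t ≤ m * (c * t / k) := by
      rw [show m * (c * t / k) = (m * c / k) * t by ring]
      have hmc' : 1 ≤ m * c / k := by
        rw [le_div_iff₀ hkr, one_mul]
        have := mul_le_mul_of_nonneg_right hmc hc.le
        rwa [div_mul_cancel₀ _ hc.ne'] at this
      nlinarith
    nlinarith
  have h2 : (1 + c * t / k) ^ k ≤ Real.exp (c * t) := by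
    have h := Real.add_one_le_exp (c * t / k)
    have h0 : 0 ≤ 1 + c * t / k := by positivity
    calc (1 + c * t / k) ^ k ≤ (Real.exp (c * t / k)) ^ k :=
          pow_le_pow_left₀ h0 (by linarith [Real.add_one_le_exp (c * t / k)]) k
      _ = Real.exp (c * t) := by rw [← Real.exp_nat_mul]; congr 1; field_simp
  have h3 : (1 + t) ^ k ≤ m ^ k * Real.exp (c * t) := by
    calc (1 + t) ^ k ≤ (m * (1 + c * t / k)) ^ k := pow_le_pow_left₀ (by positivity) h1 k
      _ = m ^ k * (1 + c * t / k) ^ k := mul_pow _ _ _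
      _ ≤ m ^ k * Real.exp (c * t) := mul_le_mul_of_nonneg_left h2 (by positivity)
  calc (1 + t) ^ k * Real.exp (-(c * t)) ≤ m ^ k * Real.exp (c * t) * Real.exp (-(c * t)) :=
        mul_le_mul_of_nonneg_right h3 (Real.exp_pos _).le
    _ = m ^ k := by rw [mul_assoc, ← Real.exp_add, add_neg_cancel, Real.exp_zero, mul_one]

/-! ## §2 The far exponential ring sum on `ℤ²` -/

/-- **THE HIGH-SHELL LATTICE SUM**: for `κ > 0`, `k : ℕ` and any radius `Rc`,
`Σ'_{z ∈ ℤ²} [Rc < ‖z‖∞]·(1+‖z‖∞)ᵏ·e^{−2κ‖z‖∞} ≤ max(1, 2k/κ)ᵏ · e^{−κ(Rc+1)} · (1 + 2/(1 − e^{−κ/4}))²` — and the summand family is summable. -/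
theorem tsum_far_pow_mul_exp_le {κ : ℝ} (hκ : 0 < κ) (k Rc : ℕ) :
    Summable (fun z : Site 2 => if (Rc : ℝ) < ‖z‖ then (1 + ‖z‖) ^ k * Real.exp (-(2 * κ * ‖z‖)) else 0) ∧
    ∑' z : Site 2, (if (Rc : ℝ) < ‖z‖ then (1 + ‖z‖) ^ k * Real.exp (-(2 * κ * ‖z‖)) else 0) ≤
      (max 1 ((2 * k : ℝ) / κ)) ^ k * Real.exp (-(κ * (Rc + 1))) * (1 + 2 * (1 - Real.exp (-(κ / 4)))⁻¹) ^ 2 := by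
  set ρ : ℝ := Real.exp (-(κ / 4)) with hρ
  have hρ0 : 0 ≤ ρ := (Real.exp_pos _).le
  have hρ1 : ρ < 1 := Real.exp_lt_one_iff.2 (by linarith)
  have hS := tsum_site_two_prod_weight hρ0 hρ1
  set P : ℝ := (max 1 ((2 * k : ℝ) / κ)) ^ k with hP
  set E : ℝ := Real.exp (-(κ * (Rc + 1))) with hE
  have hP0 : 0 ≤ P := by positivity
  have hE0 : 0 ≤ E := (Real.exp_pos _).le
  -- termwise domination by `P · E · ρ^{(|z₀|−1)+(|z₁|−1)}`
  have hdom : ∀ z : Site 2, (if (Rc : ℝ) < ‖z‖ then (1 + ‖z‖) ^ k * Real.exp (-(2 * κ * ‖z‖)) else 0) ≤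
      P * E * (ρ ^ ((z 0).natAbs - 1) * ρ ^ ((z 1).natAbs - 1)) := by
    intro z
    split_ifs with hfar
    · have hz0 : 0 ≤ ‖z‖ := norm_nonneg _
      -- (a) the weight against `e^{−κ‖z‖/2}`
      have ha : (1 + ‖z‖) ^ k * Real.exp (-(κ / 2 * ‖z‖)) ≤ P := by
        have h := one_add_pow_mul_exp_neg_le hz0 (half_pos hκ) k
        have hkk : (k : ℝ) / (κ / 2) = (2 * k : ℝ) / κ := by field_simp
        rw [hkk] at h
        exact h
      -- (b) the decay at the ring: `e^{−κ‖z‖} ≤ e^{−κ(Rc+1)}` since `‖z‖ ≥ Rc + 1` (integer coordinates)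
      have hb : Real.exp (-(κ * ‖z‖)) ≤ E := by
        rw [hE, Real.exp_le_exp, neg_le_neg_iff]
        refine mul_le_mul_of_nonneg_left ?_ hκ.le
        rw [norm_site_two_eq_max_natAbs] at hfar ⊢
        rcases lt_max_iff.1 hfar with h | h
        · have h' : Rc < (z 0).natAbs := by exact_mod_cast h
          have h'' : (Rc : ℝ) + 1 ≤ ((z 0).natAbs : ℝ) := by exact_mod_cast h'
          exact h''.trans (le_max_left _ _)
        · have h' : Rc < (z 1).natAbs := by exact_mod_cast h
          have h'' : (Rc : ℝ) + 1 ≤ ((z 1).natAbs : ℝ) := by exact_mod_cast h'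
          exact h''.trans (le_max_right _ _)
      -- (c) the last factor against p1's product weight: `e^{−κ‖z‖/2} ≤ ρ^{(|z₀|−1)+(|z₁|−1)}`
      have hc : Real.exp (-(κ / 2 * ‖z‖)) ≤ ρ ^ ((z 0).natAbs - 1) * ρ ^ ((z 1).natAbs - 1) := by
        have hn : ‖z‖ = max (((z 0).natAbs : ℕ) : ℝ) (((z 1).natAbs : ℕ) : ℝ) := norm_site_two_eq_max_natAbs z
        have h0 : (((z 0).natAbs - 1 : ℕ) : ℝ) ≤ ‖z‖ := by
          have : (((z 0).natAbs - 1 : ℕ) : ℝ) ≤ ((z 0).natAbs : ℝ) := by exact_mod_cast Nat.sub_le _ _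
          exact this.trans (hn ▸ le_max_left _ _)
        have h1 : (((z 1).natAbs - 1 : ℕ) : ℝ) ≤ ‖z‖ := by
          have : (((z 1).natAbs - 1 : ℕ) : ℝ) ≤ ((z 1).natAbs : ℝ) := by exact_mod_cast Nat.sub_le _ _
          exact this.trans (hn ▸ le_max_right _ _)
        rw [hρ, ← Real.exp_nat_mul, ← Real.exp_nat_mul, ← Real.exp_add]
        exact Real.exp_le_exp.2 (by nlinarith)
      -- combine: e^{−2κ‖z‖} = e^{−κ‖z‖/2}·e^{−κ‖z‖}·e^{−κ‖z‖/2}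
      have hsplit : Real.exp (-(2 * κ * ‖z‖)) = Real.exp (-(κ / 2 * ‖z‖)) * Real.exp (-(κ * ‖z‖)) * Real.exp (-(κ / 2 * ‖z‖)) := by
        rw [← Real.exp_add, ← Real.exp_add]; congr 1; ring
      rw [hsplit]
      calc (1 + ‖z‖) ^ k * (Real.exp (-(κ / 2 * ‖z‖)) * Real.exp (-(κ * ‖z‖)) * Real.exp (-(κ / 2 * ‖z‖)))
          = ((1 + ‖z‖) ^ k * Real.exp (-(κ / 2 * ‖z‖))) * Real.exp (-(κ * ‖z‖)) * Real.exp (-(κ / 2 * ‖z‖)) := by ring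
        _ ≤ P * E * (ρ ^ ((z 0).natAbs - 1) * ρ ^ ((z 1).natAbs - 1)) :=
          mul_le_mul (mul_le_mul ha hb (Real.exp_pos _).le hP0) hc (Real.exp_pos _).le (mul_nonneg hP0 hE0)
    · positivity
  have hnn : ∀ z : Site 2, 0 ≤ (if (Rc : ℝ) < ‖z‖ then (1 + ‖z‖) ^ k * Real.exp (-(2 * κ * ‖z‖)) else 0) := fun z => by
    split_ifs <;> positivity
  have hmaj : Summable (fun z : Site 2 => P * E * (ρ ^ ((z 0).natAbs - 1) * ρ ^ ((z 1).natAbs - 1))) := (hS.summable.mul_left (P * E))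
  have hsum : Summable (fun z : Site 2 => if (Rc : ℝ) < ‖z‖ then (1 + ‖z‖) ^ k * Real.exp (-(2 * κ * ‖z‖)) else 0) :=
    Summable.of_nonneg_of_le hnn hdom hmaj
  refine ⟨hsum, (hsum.tsum_le_tsum hdom hmaj).trans (le_of_eq ?_)⟩
  rw [tsum_mul_left, hS.tsum_eq]

end Summit.HubbardSuperconductivity.HubbardSuperconductivity.Theorems.KLRegimeSplit

end
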